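import Mathlib
import Summits.ValiantsHypothesis.ValiantsHypothesis.Theorems.BarrierLeverPartitionMinorsHitByVPAdditiveDoubleObstruction

/-!
# Route BarrierLever — item `PartitionMinorsHitByVP` (stmt-ValiantsHypothesis-19717):
# the TWO-STAR obstruction of the additive door — even the all-cores Hilbert condition is not sufficient

Helper / negative file (`--supports stmt-ValiantsHypothesis-19717`; cell valiant-natproofs, rung V4,
𝒟-side, prover seat val-np-p6 gen 4). Definition-free. Closes NO item.

Additive matrix `A[i,j] = ∏_{c ∈ w j} ℓ_c(u i)`, `ℓ_c(S) = ω₀ c + Σ_{a∈S} ω a c`; `V_d` = span of the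
inclusion indicators `i ↦ [R ⊆ u i]`, `|R| ≤ d`, of dimension `H_u(d)`. A column `j` with
`C ∪ {a} ⊆ w j` and `|w j ∖ (C ∪ {a})| ≤ d` lies in `g_C · ℓ_a · V_d`. For two elements `a₁ ≠ a₂`
outside `C` the spaces `ℓ_{a₁} V_d` and `ℓ_{a₂} V_d` always share `ℓ_{a₁} ℓ_{a₂} V_{d−1}`, and a kernel
bookkeeping that needs NO genericity (`finrank_sup_mul_le`) gives
`dim (ℓ_{a₁} V_d + ℓ_{a₂} V_d) ≤ 2 H_u(d) − H_u(d−1)` for EVERY table. Hence: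

* `mul_affine_mem_span_succ` — multiplication by `ℓ_a` maps `V_d` into `V_{d+1}`.
* `finrank_sup_mul_le` — `dim (ℓ₁ V + ℓ₂ V) + dim V' ≤ 2 dim V` whenever `ℓ₁ V', ℓ₂ V' ≤ V` and `V' ≤ V`
  (pointwise products; pure linear algebra, all tables).
* **`additiveMatrix_det_eq_zero_of_twoStars`** — if more than `2 H_u(d+1) − H_u(d)` columns lie in the
  union of the two stars `{C ∪ {a₁} ⊆ w, |w ∖ (C ∪ {a₁})| ≤ d+1}` and `{C ∪ {a₂} ⊆ w, |w ∖ (C ∪ {a₂})| ≤ d+1}`,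
  the additive matrix is singular for EVERY table.
* **`additive_twoStar_example_det_eq_zero`** — `h = 6`, rows = the 4-subcube `2^{0123}` (`H(0)=1`,
  `H(1) ≤ 5`), columns `{0},{02},{03},{04},{05},{1},{12},{13},{14},{15},{234},{235},{245},{345},{2345},
  {012345}`: the two radius-1 stars of `{0}` and `{1}` hold 10 > 2·5 − 1 columns ⇒ singular for every
  table — although EVERY single-core count passes (each star has 5 ≤ H(1) = 5 members; global counts
  2 ≤ 5, 10 ≤ 11, 14 ≤ 15, 16 ≤ 16). So the all-cores Hilbert condition (H1′ of memo RESIDUE-v6) is not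
  sufficient either: the reach of the additive leaf is a rank condition on the lattice generated by the
  subspaces `ℓ^C · V_d`, not a counting condition.

WHAT THIS IS NOT: nothing on item 19717 itself, crux 14610 or VP vs VNP.
-/

set_option linter.dupNamespace false

namespace Summit.ValiantsHypothesis.ValiantsHypothesis.Theorems.BarrierLever.AdditiveDoor

open Finset

noncomputable section

variable {h : ℕ}

/-! ## 1. Multiplication by an affine function raises the indicator degree by one -/

/-- `ℓ_a(u i) · [R ⊆ u i] = ω₀ a · [R ⊆ u i] + Σ_b ω b a · [insert b R ⊆ u i]`. -/
theorem affine_mul_indicator {ι : Type*} (u : ι → Finset (Fin h)) (ω₀ : Fin h → ℂ)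
    (ω : Fin h → Fin h → ℂ) (a : Fin h) (R : Finset (Fin h)) :
    (fun i => (ω₀ a + ∑ b ∈ u i, ω b a) * (if R ⊆ u i then (1 : ℂ) else 0)) =
      ω₀ a • (fun i => if R ⊆ u i then (1 : ℂ) else 0) +
        ∑ b : Fin h, ω b a • (fun i => if insert b R ⊆ u i then (1 : ℂ) else 0) := by
  classical
  funext i
  simp only [Pi.add_apply, Finset.sum_apply, Pi.smul_apply, smul_eq_mul]
  by_cases hR : R ⊆ u i
  · rw [if_pos hR, mul_one]
    congr 1
    · simp
    · rw [← Finset.sum_filter_add_sum_filter_not Finset.univ (fun b => b ∈ u i)]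
      have h1 : ∑ b ∈ Finset.univ.filter (fun b => b ∈ u i), ω b a *
          (if insert b R ⊆ u i then (1 : ℂ) else 0) = ∑ b ∈ u i, ω b a := by
        rw [show Finset.univ.filter (fun b => b ∈ u i) = u i from by ext b; simp]
        refine Finset.sum_congr rfl fun b hb => ?_
        rw [if_pos (Finset.insert_subset hb hR), mul_one]
      have h2 : ∑ b ∈ Finset.univ.filter (fun b => ¬ b ∈ u i), ω b a *
          (if insert b R ⊆ u i then (1 : ℂ) else 0) = 0 := by
        refine Finset.sum_eq_zero fun b hb => ?_
        rw [Finset.mem_filter] at hb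
        rw [if_neg (fun hins => hb.2 (hins (Finset.mem_insert_self b R))), mul_zero]
      rw [h1, h2, add_zero]
  · rw [if_neg hR, mul_zero]
    have h2 : ∀ b, (if insert b R ⊆ u i then (1 : ℂ) else 0) = 0 := fun b =>
      if_neg (fun hins => hR ((Finset.subset_insert b R).trans hins))
    simp [h2]

/-- Multiplication by `ℓ_a` maps `V_d = span {[R ⊆ u i] : |R| ≤ d}` into `V_{d+1}`. -/
theorem mul_affine_mem_span_succ {ι : Type*} (u : ι → Finset (Fin h)) (ω₀ : Fin h → ℂ)
    (ω : Fin h → Fin h → ℂ) (a : Fin h) (d : ℕ) (v : ι → ℂ)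
    (hv : v ∈ Submodule.span ℂ (Set.range fun R : {R : Finset (Fin h) // R.card ≤ d} =>
      fun i => if R.1 ⊆ u i then (1 : ℂ) else 0)) :
    (fun i => (ω₀ a + ∑ b ∈ u i, ω b a) * v i) ∈
      Submodule.span ℂ (Set.range fun R : {R : Finset (Fin h) // R.card ≤ d + 1} =>
        fun i => if R.1 ⊆ u i then (1 : ℂ) else 0) := by
  classical
  refine Submodule.span_induction (p := fun v _ => (fun i => (ω₀ a + ∑ b ∈ u i, ω b a) * v i) ∈
    Submodule.span ℂ (Set.range fun R : {R : Finset (Fin h) // R.card ≤ d + 1} =>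
      fun i => if R.1 ⊆ u i then (1 : ℂ) else 0)) ?_ ?_ ?_ ?_ hv
  · rintro _ ⟨R, rfl⟩
    have hRcard : R.1.card ≤ d + 1 := R.2.trans (Nat.le_succ d)
    have hRb : ∀ b, (insert b R.1).card ≤ d + 1 := fun b =>
      (Finset.card_insert_le b R.1).trans (Nat.succ_le_succ R.2)
    rw [affine_mul_indicator u ω₀ ω a R.1]
    refine Submodule.add_mem _ (Submodule.smul_mem _ _ (Submodule.subset_span ⟨⟨R.1, hRcard⟩, rfl⟩))
      (Submodule.sum_mem _ fun b _ => Submodule.smul_mem _ _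
        (Submodule.subset_span ⟨⟨insert b R.1, hRb b⟩, rfl⟩))
  · have : (fun i => (ω₀ a + ∑ b ∈ u i, ω b a) * (0 : ι → ℂ) i) = 0 := by funext i; simp
    rw [this]; exact Submodule.zero_mem _
  · intro x y _ _ hx hy
    have : (fun i => (ω₀ a + ∑ b ∈ u i, ω b a) * (x + y) i) =
        (fun i => (ω₀ a + ∑ b ∈ u i, ω b a) * x i) + fun i => (ω₀ a + ∑ b ∈ u i, ω b a) * y i := by
      funext i; simp [mul_add]
    rw [this]; exact Submodule.add_mem _ hx hy
  · intro r x _ hx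
    have : (fun i => (ω₀ a + ∑ b ∈ u i, ω b a) * (r • x) i) =
        r • fun i => (ω₀ a + ∑ b ∈ u i, ω b a) * x i := by
      funext i; simp [mul_left_comm]
    rw [this]; exact Submodule.smul_mem _ _ hx

/-! ## 2. Linear algebra: two multiplication images sharing a product image -/

/-- **Kernel bookkeeping (all tables).** In the algebra of functions `ι → ℂ`, let `V' ≤ V` be subspaces
with `ℓ₁ • V' ≤ V` and `ℓ₂ • V' ≤ V` (pointwise products). Then
`dim (ℓ₁ • V ⊔ ℓ₂ • V) + dim V' ≤ 2 dim V`: the intersection contains `ℓ₁ℓ₂ • V'`, whose rank defect is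
at most the sum of the rank defects of `ℓ₁ •` and `ℓ₂ •` on `V`. -/
theorem finrank_sup_mul_le {ι : Type*} [Fintype ι] (ℓ₁ ℓ₂ : ι → ℂ) (V V' : Submodule ℂ (ι → ℂ))
    (hV' : V' ≤ V) (h1 : ∀ v ∈ V', ℓ₁ * v ∈ V) (h2 : ∀ v ∈ V', ℓ₂ * v ∈ V) :
    Module.finrank ℂ ↥(V.map (LinearMap.mulLeft ℂ ℓ₁) ⊔ V.map (LinearMap.mulLeft ℂ ℓ₂)) +
      Module.finrank ℂ V' ≤ 2 * Module.finrank ℂ V := by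
  set m₁ : (ι → ℂ) →ₗ[ℂ] (ι → ℂ) := LinearMap.mulLeft ℂ ℓ₁ with hm₁
  set m₂ : (ι → ℂ) →ₗ[ℂ] (ι → ℂ) := LinearMap.mulLeft ℂ ℓ₂ with hm₂
  set m₁₂ : (ι → ℂ) →ₗ[ℂ] (ι → ℂ) := LinearMap.mulLeft ℂ (ℓ₁ * ℓ₂) with hm₁₂
  set A := V.map m₁ with hA
  set B := V.map m₂ with hB
  set Cp := V'.map m₁₂ with hCp
  set K₁ := V ⊓ LinearMap.ker m₁ with hK₁
  set K₂ := V ⊓ LinearMap.ker m₂ with hK₂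
  set K := V' ⊓ LinearMap.ker m₁₂ with hK
  -- rank–nullity for a restricted map, with the kernel expressed as an honest subspace
  have rn : ∀ (f : (ι → ℂ) →ₗ[ℂ] (ι → ℂ)) (S : Submodule ℂ (ι → ℂ)),
      Module.finrank ℂ ↥(S.map f) + Module.finrank ℂ ↥(S ⊓ LinearMap.ker f) =
        Module.finrank ℂ S := by
    intro f S
    have h := LinearMap.finrank_range_add_finrank_ker (f.domRestrict S)
    rw [LinearMap.range_domRestrict, LinearMap.ker_domRestrict,
      ← Submodule.finrank_map_subtype_eq S (Submodule.comap S.subtype (LinearMap.ker f)),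
      Submodule.map_comap_subtype] at h
    exact h
  have hrA := rn m₁ V
  have hrB := rn m₂ V
  have hrC := rn m₁₂ V'
  rw [← hA, ← hK₁] at hrA
  rw [← hB, ← hK₂] at hrB
  rw [← hCp, ← hK] at hrC
  -- `Cp ≤ A ⊓ B`
  have hCAB : Cp ≤ A ⊓ B := by
    rintro _ ⟨v, hv, rfl⟩
    refine ⟨⟨ℓ₂ * v, h2 v hv, ?_⟩, ⟨ℓ₁ * v, h1 v hv, ?_⟩⟩
    · rw [hm₁, hm₁₂, LinearMap.mulLeft_apply, LinearMap.mulLeft_apply, mul_assoc]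
    · rw [hm₂, hm₁₂, LinearMap.mulLeft_apply, LinearMap.mulLeft_apply, ← mul_assoc, mul_comm ℓ₂ ℓ₁]
  have hinf : Module.finrank ℂ Cp ≤ Module.finrank ℂ ↥(A ⊓ B) := Submodule.finrank_mono hCAB
  have hsup : Module.finrank ℂ ↥(A ⊔ B) + Module.finrank ℂ ↥(A ⊓ B) =
      Module.finrank ℂ A + Module.finrank ℂ B := Submodule.finrank_sup_add_finrank_inf_eq A B
  -- kernel comparison: `dim K ≤ dim K₁ + dim K₂` via multiplication by `ℓ₂` on `K`
  have hrK := rn m₂ K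
  have hmapK : K.map m₂ ≤ K₁ := by
    rintro _ ⟨v, hv, rfl⟩
    rw [hK] at hv
    obtain ⟨hvV', hvker⟩ := Submodule.mem_inf.mp hv
    have hvker' : ℓ₁ * ℓ₂ * v = 0 := hvker
    refine Submodule.mem_inf.mpr ⟨h2 v hvV', ?_⟩
    show ℓ₁ * (ℓ₂ * v) = 0
    rw [← mul_assoc]
    exact hvker'
  have hkerK : K ⊓ LinearMap.ker m₂ ≤ K₂ := by
    intro v hv
    obtain ⟨hvK, hv2⟩ := Submodule.mem_inf.mp hv
    rw [hK] at hvK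
    exact Submodule.mem_inf.mpr ⟨hV' (Submodule.mem_inf.mp hvK).1, hv2⟩
  have hk1 : Module.finrank ℂ ↥(K.map m₂) ≤ Module.finrank ℂ K₁ := Submodule.finrank_mono hmapK
  have hk2 : Module.finrank ℂ ↥(K ⊓ LinearMap.ker m₂) ≤ Module.finrank ℂ K₂ :=
    Submodule.finrank_mono hkerK
  have hfin : Module.finrank ℂ ↥(A ⊔ B) + Module.finrank ℂ V' ≤ 2 * Module.finrank ℂ V := by
    omega
  simpa [hA, hB] using hfin

/-! ## 3. The two-star obstruction -/

/-- **Two-star obstruction.** Let `a₁ ≠ a₂` be outside `C`. If more than `2 H_u(d+1) − H_u(d)` columns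
`j` satisfy `C ∪ {a₁} ⊆ w j, |w j ∖ (C ∪ {a₁})| ≤ d + 1` or `C ∪ {a₂} ⊆ w j, |w j ∖ (C ∪ {a₂})| ≤ d + 1`,
the additive matrix is singular for EVERY table. -/
theorem additiveMatrix_det_eq_zero_of_twoStars {ι : Type*} [Fintype ι] [DecidableEq ι]
    (u w : ι → Finset (Fin h)) (ω₀ : Fin h → ℂ) (ω : Fin h → Fin h → ℂ) (C : Finset (Fin h))
    (a₁ a₂ : Fin h) (ha₁ : a₁ ∉ C) (ha₂ : a₂ ∉ C) (d : ℕ)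
    (hcount : 2 * (Matrix.of fun (i : ι) (R : {R : Finset (Fin h) // R.card ≤ d + 1}) =>
        if R.1 ⊆ u i then (1 : ℂ) else 0).rank <
      (Finset.univ.filter fun j =>
        (insert a₁ C ⊆ w j ∧ (w j \ insert a₁ C).card ≤ d + 1) ∨
        (insert a₂ C ⊆ w j ∧ (w j \ insert a₂ C).card ≤ d + 1)).card +
      (Matrix.of fun (i : ι) (R : {R : Finset (Fin h) // R.card ≤ d}) =>
        if R.1 ⊆ u i then (1 : ℂ) else 0).rank) :
    (Matrix.of fun i j : ι => ∏ c ∈ w j, (ω₀ c + ∑ a ∈ u i, ω a c)).det = 0 := by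
  classical
  set M : Matrix ι ι ℂ := Matrix.of fun i j : ι => ∏ c ∈ w j, (ω₀ c + ∑ a ∈ u i, ω a c) with hM
  set E : Matrix ι {R : Finset (Fin h) // R.card ≤ d + 1} ℂ :=
    Matrix.of fun i R => if R.1 ⊆ u i then (1 : ℂ) else 0 with hE
  set E' : Matrix ι {R : Finset (Fin h) // R.card ≤ d} ℂ :=
    Matrix.of fun i R => if R.1 ⊆ u i then (1 : ℂ) else 0 with hE'
  set V : Submodule ℂ (ι → ℂ) := Submodule.span ℂ (Set.range E.col) with hV
  set V' : Submodule ℂ (ι → ℂ) := Submodule.span ℂ (Set.range E'.col) with hV'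
  set ℓ : Fin h → ι → ℂ := fun a i => ω₀ a + ∑ b ∈ u i, ω b a with hℓ
  set g : ι → ℂ := fun i => ∏ c ∈ C, ℓ c i with hg
  set P : ι → Prop := fun j => (insert a₁ C ⊆ w j ∧ (w j \ insert a₁ C).card ≤ d + 1) ∨
      (insert a₂ C ⊆ w j ∧ (w j \ insert a₂ C).card ≤ d + 1) with hP
  have hrankV : Module.finrank ℂ V = E.rank := (Matrix.rank_eq_finrank_span_cols E).symm
  have hrankV' : Module.finrank ℂ V' = E'.rank := (Matrix.rank_eq_finrank_span_cols E').symm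
  -- identification of the spans with the `Set.range fun R => …` form of §1
  have hVeq : V = Submodule.span ℂ (Set.range fun R : {R : Finset (Fin h) // R.card ≤ d + 1} =>
      fun i => if R.1 ⊆ u i then (1 : ℂ) else 0) := by
    rw [hV]; rfl
  have hV'eq : V' = Submodule.span ℂ (Set.range fun R : {R : Finset (Fin h) // R.card ≤ d} =>
      fun i => if R.1 ⊆ u i then (1 : ℂ) else 0) := by
    rw [hV']; rfl
  have hV'V : V' ≤ V := by
    rw [hV, hV']
    refine Submodule.span_le.mpr ?_
    rintro _ ⟨R, rfl⟩
    refine Submodule.subset_span ⟨⟨R.1, R.2.trans (Nat.le_succ d)⟩, ?_⟩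
    funext i; simp [hE, hE', Matrix.col]
  have hmul : ∀ a : Fin h, ∀ v ∈ V', ℓ a * v ∈ V := by
    intro a v hv
    rw [hV'eq] at hv
    have := mul_affine_mem_span_succ u ω₀ ω a d v hv
    rw [hVeq]
    exact this
  -- the span of the two star spaces, pushed by `g`
  set A := V.map (LinearMap.mulLeft ℂ (ℓ a₁)) with hA
  set B := V.map (LinearMap.mulLeft ℂ (ℓ a₂)) with hB
  set Gm : (ι → ℂ) →ₗ[ℂ] (ι → ℂ) := LinearMap.mulLeft ℂ g with hGm
  set W : Submodule ℂ (ι → ℂ) := (A ⊔ B).map Gm with hW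
  have hdimAB : Module.finrank ℂ ↥(A ⊔ B) + Module.finrank ℂ V' ≤ 2 * Module.finrank ℂ V :=
    finrank_sup_mul_le (ℓ a₁) (ℓ a₂) V V' hV'V (hmul a₁) (hmul a₂)
  have hdimW : Module.finrank ℂ W ≤ Module.finrank ℂ ↥(A ⊔ B) := Submodule.finrank_map_le _ _
  -- every star column lies in `W`
  have hcol : ∀ j : {j : ι // P j}, M.col j.1 ∈ W := by
    intro j
    -- common shape: core `insert a C` with `a ∉ C`
    have key : ∀ a : Fin h, a ∉ C → insert a C ⊆ w j.1 → (w j.1 \ insert a C).card ≤ d + 1 →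
        M.col j.1 ∈ (V.map (LinearMap.mulLeft ℂ (ℓ a))).map Gm := by
      intro a haC hsub hcard
      have hmem := prod_affine_mem_span_indicators u ω₀ ω (w j.1 \ insert a C)
      have hsubV : Submodule.span ℂ (Set.range fun R : {R : Finset (Fin h) //
          R.card ≤ (w j.1 \ insert a C).card} => fun i => if R.1 ⊆ u i then (1 : ℂ) else 0) ≤ V := by
        refine Submodule.span_le.mpr ?_
        rintro _ ⟨R, rfl⟩
        rw [hV]
        refine Submodule.subset_span ⟨⟨R.1, R.2.trans hcard⟩, ?_⟩
        funext i; simp [hE, Matrix.col]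
      have hv : (fun i => ∏ c ∈ w j.1 \ insert a C, (ω₀ c + ∑ b ∈ u i, ω b c)) ∈ V := hsubV hmem
      have hcolj : M.col j.1 = Gm (LinearMap.mulLeft ℂ (ℓ a)
          (fun i => ∏ c ∈ w j.1 \ insert a C, (ω₀ c + ∑ b ∈ u i, ω b c))) := by
        funext i
        simp only [hM, hGm, hg, hℓ, Matrix.col_apply, Matrix.of_apply, LinearMap.mulLeft_apply,
          Pi.mul_apply]
        rw [← Finset.prod_sdiff hsub, Finset.prod_insert haC]
        ring
      rw [hcolj]
      exact Submodule.mem_map_of_mem (Submodule.mem_map_of_mem hv)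
    have hAW : (V.map (LinearMap.mulLeft ℂ (ℓ a₁))).map Gm ≤ W := by
      rw [hW]; exact Submodule.map_mono le_sup_left
    have hBW : (V.map (LinearMap.mulLeft ℂ (ℓ a₂))).map Gm ≤ W := by
      rw [hW]; exact Submodule.map_mono le_sup_right
    rcases j.2 with ⟨hsub, hcard⟩ | ⟨hsub, hcard⟩
    · exact hAW (key a₁ ha₁ hsub hcard)
    · exact hBW (key a₂ ha₂ hsub hcard)
  -- dimension count: `dim W < #star columns`
  have hcardJ : Module.finrank ℂ ({j : ι // P j} → ℂ) = (Finset.univ.filter P).card := by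
    rw [Module.finrank_fintype_fun_eq_card, Fintype.card_subtype]
  have hlt : Module.finrank ℂ W < (Finset.univ.filter P).card := by
    have h1 : Module.finrank ℂ ↥(A ⊔ B) + E'.rank ≤ 2 * E.rank := by
      rw [← hrankV, ← hrankV']; exact hdimAB
    have h2 : 2 * E.rank < (Finset.univ.filter P).card + E'.rank := hcount
    omega
  -- the linear map `v ↦ Σ_j v_j col_j` on `J → ℂ` lands in `W`, which is too small
  let Φ : ({j : ι // P j} → ℂ) →ₗ[ℂ] (ι → ℂ) :=
    { toFun := fun v i => ∑ j : {j : ι // P j}, v j * M i j.1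
      map_add' := fun x y => by funext i; simp [add_mul, Finset.sum_add_distrib]
      map_smul' := fun r x => by funext i; simp [Finset.mul_sum, mul_assoc] }
  have hΦapply : ∀ v i, Φ v i = ∑ j : {j : ι // P j}, v j * M i j.1 := fun v i => rfl
  have hΦmem : ∀ v, Φ v ∈ W := by
    intro v
    have : Φ v = ∑ j : {j : ι // P j}, v j • M.col j.1 := by
      funext i
      rw [hΦapply]
      simp [Matrix.col_apply, Finset.sum_apply, smul_eq_mul]
    rw [this]
    exact Submodule.sum_mem _ fun j _ => Submodule.smul_mem _ _ (hcol j)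
  have hker : LinearMap.ker (LinearMap.codRestrict W Φ hΦmem) ≠ ⊥ := by
    refine LinearMap.ker_ne_bot_of_finrank_lt ?_
    rw [hcardJ]
    exact hlt
  obtain ⟨v, hvker, hvne⟩ := (Submodule.ne_bot_iff _).mp hker
  have hΦv : Φ v = 0 := by
    have := congrArg Subtype.val (LinearMap.mem_ker.mp hvker)
    simpa using this
  refine (Matrix.exists_mulVec_eq_zero_iff).mp
    ⟨fun i => if hi : P i then v ⟨i, hi⟩ else 0, ?_, ?_⟩
  · intro hzero
    apply hvne
    funext j
    have := congrFun hzero j.1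
    simp only [dif_pos j.2, Pi.zero_apply] at this
    exact this
  · funext i
    have hi : ∑ j : {j : ι // P j}, v j * M i j.1 = 0 := by
      rw [← hΦapply, hΦv]; rfl
    rw [Matrix.mulVec, dotProduct, Pi.zero_apply]
    calc ∑ j, M i j * (if hj : P j then v ⟨j, hj⟩ else 0)
        = ∑ j ∈ Finset.univ.filter P, M i j * (if hj : P j then v ⟨j, hj⟩ else 0) := by
          refine (Finset.sum_subset (Finset.filter_subset _ _) fun j _ hj => ?_).symm
          have hj' : ¬ P j := by simpa using hj
          rw [dif_neg hj', mul_zero]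
      _ = ∑ j : {j : ι // P j}, M i j.1 * (if hj : P j.1 then v ⟨j.1, hj⟩ else 0) :=
          Finset.sum_subtype _ (fun j => by simp) _
      _ = ∑ j : {j : ι // P j}, v j * M i j.1 :=
          Fintype.sum_congr _ _ fun j => by rw [dif_pos j.2, mul_comm]
      _ = 0 := hi

/-- **H1′ is false: two full stars.** `h = 6`, rows = the 4-subcube `2^{0123}`, columns = the radius-1
stars of `{0}` and `{1}` (five members each, none shared) plus six large sets: `10 > 2·H(1) − H(0)`
(`H(1) ≤ 5` by `rank_indicatorsOne_le`, `H(0) = 1`), so the additive matrix is singular for every table. -/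
theorem additive_twoStar_example_det_eq_zero (ω₀ : Fin 6 → ℂ) (ω : Fin 6 → Fin 6 → ℂ) :
    (Matrix.of fun i j : Fin 16 =>
      ∏ c ∈ (![{0}, {0, 2}, {0, 3}, {0, 4}, {0, 5}, {1}, {1, 2}, {1, 3}, {1, 4}, {1, 5},
              {2, 3, 4}, {2, 3, 5}, {2, 4, 5}, {3, 4, 5}, {2, 3, 4, 5}, {0, 1, 2, 3, 4, 5}] :
          Fin 16 → Finset (Fin 6)) j,
        (ω₀ c + ∑ a ∈ (![∅, {0}, {1}, {0, 1}, {2}, {0, 2}, {1, 2}, {0, 1, 2}, {3}, {0, 3}, {1, 3},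
              {0, 1, 3}, {2, 3}, {0, 2, 3}, {1, 2, 3}, {0, 1, 2, 3}] :
          Fin 16 → Finset (Fin 6)) i, ω a c)).det = 0 := by
  refine additiveMatrix_det_eq_zero_of_twoStars _ _ ω₀ ω ∅ 0 1 (by decide) (by decide) 0 ?_
  -- `H(1) ≤ 1 + |⋃ u| = 5`, `H(0) ≥ 1` (the column of `∅` is nonzero), and the two stars hold 10 columns
  have h1 := rank_indicatorsOne_le
    (![∅, {0}, {1}, {0, 1}, {2}, {0, 2}, {1, 2}, {0, 1, 2}, {3}, {0, 3}, {1, 3},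
      {0, 1, 3}, {2, 3}, {0, 2, 3}, {1, 2, 3}, {0, 1, 2, 3}] : Fin 16 → Finset (Fin 6))
  have hU : (Finset.univ.biUnion (![∅, {0}, {1}, {0, 1}, {2}, {0, 2}, {1, 2}, {0, 1, 2}, {3}, {0, 3},
      {1, 3}, {0, 1, 3}, {2, 3}, {0, 2, 3}, {1, 2, 3}, {0, 1, 2, 3}] : Fin 16 → Finset (Fin 6))).card
      = 4 := by decide
  have hcnt : (Finset.univ.filter fun j : Fin 16 =>
      (insert (0 : Fin 6) ∅ ⊆ (![{0}, {0, 2}, {0, 3}, {0, 4}, {0, 5}, {1}, {1, 2}, {1, 3}, {1, 4},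
          {1, 5}, {2, 3, 4}, {2, 3, 5}, {2, 4, 5}, {3, 4, 5}, {2, 3, 4, 5}, {0, 1, 2, 3, 4, 5}] :
          Fin 16 → Finset (Fin 6)) j ∧
        ((![{0}, {0, 2}, {0, 3}, {0, 4}, {0, 5}, {1}, {1, 2}, {1, 3}, {1, 4}, {1, 5}, {2, 3, 4},
          {2, 3, 5}, {2, 4, 5}, {3, 4, 5}, {2, 3, 4, 5}, {0, 1, 2, 3, 4, 5}] :
          Fin 16 → Finset (Fin 6)) j \ insert (0 : Fin 6) ∅).card ≤ 0 + 1) ∨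
      (insert (1 : Fin 6) ∅ ⊆ (![{0}, {0, 2}, {0, 3}, {0, 4}, {0, 5}, {1}, {1, 2}, {1, 3}, {1, 4},
          {1, 5}, {2, 3, 4}, {2, 3, 5}, {2, 4, 5}, {3, 4, 5}, {2, 3, 4, 5}, {0, 1, 2, 3, 4, 5}] :
          Fin 16 → Finset (Fin 6)) j ∧
        ((![{0}, {0, 2}, {0, 3}, {0, 4}, {0, 5}, {1}, {1, 2}, {1, 3}, {1, 4}, {1, 5}, {2, 3, 4},
          {2, 3, 5}, {2, 4, 5}, {3, 4, 5}, {2, 3, 4, 5}, {0, 1, 2, 3, 4, 5}] :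
          Fin 16 → Finset (Fin 6)) j \ insert (1 : Fin 6) ∅).card ≤ 0 + 1)).card = 10 := by decide
  -- `H(0) ≥ 1`: the column of `∅` is the all-ones vector
  have h0 : 1 ≤ (Matrix.of fun (i : Fin 16) (R : {R : Finset (Fin 6) // R.card ≤ 0}) =>
      if R.1 ⊆ (![∅, {0}, {1}, {0, 1}, {2}, {0, 2}, {1, 2}, {0, 1, 2}, {3}, {0, 3}, {1, 3},
        {0, 1, 3}, {2, 3}, {0, 2, 3}, {1, 2, 3}, {0, 1, 2, 3}] : Fin 16 → Finset (Fin 6)) i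
      then (1 : ℂ) else 0).rank := by
    set E₀ := (Matrix.of fun (i : Fin 16) (R : {R : Finset (Fin 6) // R.card ≤ 0}) =>
      if R.1 ⊆ (![∅, {0}, {1}, {0, 1}, {2}, {0, 2}, {1, 2}, {0, 1, 2}, {3}, {0, 3}, {1, 3},
        {0, 1, 3}, {2, 3}, {0, 2, 3}, {1, 2, 3}, {0, 1, 2, 3}] : Fin 16 → Finset (Fin 6)) i
      then (1 : ℂ) else 0) with hE₀
    have hcol : E₀.col ⟨∅, by simp⟩ ≠ 0 := by
      intro hz
      have := congrFun hz 0
      simp [hE₀, Matrix.col_apply] at this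
    rw [Matrix.rank_eq_finrank_span_cols, ← finrank_span_singleton (K := ℂ) hcol]
    exact Submodule.finrank_mono (Submodule.span_mono (Set.singleton_subset_iff.mpr ⟨_, rfl⟩))
  have h1' : (Matrix.of fun (i : Fin 16) (R : {R : Finset (Fin 6) // R.card ≤ 0 + 1}) =>
      if R.1 ⊆ (![∅, {0}, {1}, {0, 1}, {2}, {0, 2}, {1, 2}, {0, 1, 2}, {3}, {0, 3}, {1, 3},
        {0, 1, 3}, {2, 3}, {0, 2, 3}, {1, 2, 3}, {0, 1, 2, 3}] : Fin 16 → Finset (Fin 6)) i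
      then (1 : ℂ) else 0).rank ≤ 5 := by
    have : (1 : ℕ) + 4 = 5 := rfl
    rw [hU] at h1
    exact h1
  rw [hcnt]
  omega

end

end Summit.ValiantsHypothesis.ValiantsHypothesis.Theorems.BarrierLever.AdditiveDoor
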